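import Summits.BirchSwinnertonDyer.BirchSwinnertonDyer.Theorems.EisensteinPrimesMazurMCOnX1RankZero
import Literature.NumberTheory.EllipticCurves.Rank1Residual.Typed.WuthrichUpperBound
import Literature.NumberTheory.EllipticCurves.QuadraticTwist
import HarnessLib

/-!
# Crux idea g9 — DEFINITE SQUARE LAW (bsd-eis-idea g9; crux `stmt-BirchSwinnertonDyer-19035`,
decl `Summit.BirchSwinnertonDyer.BirchSwinnertonDyer.Theses.EisensteinPrimes.MazurMCOnX1RankZero`)

Lever (one sentence): over a DEFINITE imaginary quadratic companion field `K = ℚ(√d)` (odd twist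
`E₀^{(d)}` of Greenberg–Vatsal type, hence `BSD_p`-SOLVED), the exact Gross–Zhang–Cai–Shu–Tian formula
makes `L(E₀,1)·L(E₀^{(d)},1)` a SQUARE `P_K(f)²` times a `K`-independent constant, so the unknown
exponent `ord_p #Ш_an(E₀)` of the θ = 1 (rational `p`-torsion) rank-0 X1 curve is
`2·ord_p P_K(f) + ε_p(E₀, N⁻) − (GV-known companion exponent)`; choosing `K` with `P_K(f)` a `p`-unit
(Eisenstein degeneration of Gross periods / equidistribution of Gross points) leaves an `L`-FREE
identity: the missing lower bound `ord_p #Ш_an(E₀) ≤ ord_p #Ш(E₀)` becomes the statement that the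
EISENSTEIN DEFECT `ε_p` of the Ribet–Takahashi degree comparison `deg φ_{X₀(N)} / (deg_B · c_{N⁻})`,
net of the companion's (known) exponent, is carried by `Ш(E₀)[p^∞]·∏c/#tors²` (`DefectVisible`).

Typed here (all `def … : Prop`, no axioms, no sorry):
* `CompanionParityLaw p`  — the EMPIRICAL square law in pure BSD currency (census: p = 3, 126/126
  companion pairs with equal splitting data have EVEN exponent difference; falsifier F-H, this folder);
* interface `DefiniteShadow W p` (posited: `periodExp d = ord_p P_K(f)`, `defect d = ε_p(E₀,N⁻(d))`)
  with the laws `SquareLaw`, `PeriodUnitExists`, `DefectVisible` stated SEPARATELY (existence is never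
  smuggled into the interface);
* PROVED composition `lalgExp_le_of_squareLaw`: SquareLaw ∧ PeriodUnitExists ∧ DefectVisible ⇒ the
  rank-0 print-shape LOWER bound `ord_p (L(E₀,1)/Ω) ≤ ord_p #Ш + ord_p ∏c − 2 ord_p #tors` at `E₀`
  (the tree converts this to `MissingLowerBoundAt`/`BSDp` by bookkeeping + Kato–Wuthrich:
  `bsdp_of_pPart`, `missingPPartAt_of_lower_of_upper`, `bsdp_of_missingLowerBoundAt_of_wuthrich`, and
  `mazurMCOnX1RankZero_iff_forall_bsdp` closes the crux pairwise).
-/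

set_option linter.dupNamespace false

noncomputable section

open scoped Classical
open WeierstrassCurve Literature.NumberTheory.EllipticCurves
open Literature.NumberTheory.EllipticCurves.Rank1Residual
open Literature.NumberTheory.EllipticCurves.Rank1Residual.Typed

namespace Summit.BirchSwinnertonDyer.BirchSwinnertonDyer.Cruxes.MazurMCOnX1RankZero.DefiniteSquareLaw

/-- The rank-0 algebraic `L`-value of a (globally minimal) model: `L(W,1)/Ω_W = q ∈ ℚ`
(the tree's `PPartRankZero` currency, `Rank1Residual/PrintShapeTorsion.lean`). -/
def IsLalg (W : WeierstrassCurve ℚ) [W.IsElliptic] (q : ℚ) : Prop :=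
  W.entireLFunction 1 / (W.realPeriodRat : ℂ) = (q : ℂ)

/-- Bad primes of a globally minimal model = prime support of the minimal discriminant. -/
def badPrimes (W : WeierstrassCurve ℚ) : Finset ℕ := (W.Δ).num.natAbs.primeFactors

/-- Semistable (every bad prime multiplicative): for a MINIMAL model, `ℓ ∣ Δ` and `ℓ ∤ c₄`
(valid at `ℓ = 2, 3` too: `c₄ ≡ b₂²` (mod 3), `c₄ ≡ a₁⁴` (mod 2)). -/
def Semistable (W : WeierstrassCurve ℚ) : Prop := ∀ ℓ ∈ badPrimes W, ¬ ((ℓ : ℤ) ∣ (W.c₄).num)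

/-- `d₁, d₂` split the same way at every bad prime of `W` (Kronecker symbols agree). -/
def SameSplitting (W : WeierstrassCurve ℚ) (d₁ d₂ : ℤ) : Prop :=
  ∀ ℓ ∈ badPrimes W, jacobiSym d₁ ℓ = jacobiSym d₂ ℓ

/-- Number of bad primes of `W` inert in `ℚ(√d)`. -/
def inertCount (W : WeierstrassCurve ℚ) (d : ℤ) : ℕ :=
  ((badPrimes W).filter fun ℓ => jacobiSym d ℓ = -1).card

/-- DEFINITE admissibility of the companion discriminant `d` for `(W, p)`: `d < 0` squarefree,
`p ∤ d`, `d` coprime to the minimal discriminant (all bad primes unramified in `K = ℚ(√d)`), and an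
ODD number of bad primes inert in `K` (sign `+1` for `W/K`: Gross's definite quaternion algebra
`B` ramified at `N⁻ =` the inert primes and `∞`). -/
def Admissible (W : WeierstrassCurve ℚ) (p : ℕ) (d : ℤ) : Prop :=
  d < 0 ∧ Squarefree d ∧ ¬ ((p : ℤ) ∣ d) ∧ Int.gcd d (W.Δ).num = 1 ∧ Odd (inertCount W d)

/-- `Wd` is (a model of) the quadratic twist `W^{(d)}`. -/
def IsCompanion (W : WeierstrassCurve ℚ) (d : ℤ) (Wd : WeierstrassCurve ℚ) : Prop :=
  ∃ C : WeierstrassCurve.VariableChange ℚ, C • Wd = W.quadraticTwist (d : ℚ)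

/-- **First lemma / cheapest falsifier (EMPIRICAL SQUARE LAW, typed).** For a rank-0 X1 curve `W`
with rational `p`-torsion (θ = 1 leaf), semistable, and two DEFINITE-admissible companions
`d₁, d₂` with the same splitting data at the bad primes (same `B`), the rank-0 BSD exponents
`ord_p (L(W^{(dᵢ)},1)/Ω)` of the two companions have the SAME PARITY — the shadow of
`L(W,1)L(W^{(d)},1) ≐ P_K(f)² · (constant of (W,B))`. Census (p = 3, N < 2·10⁴, companions in
Cremona's table N·d² < 5·10⁵): 36 groups, 126 pairs, offsets {0: 118, 2: 8}, odd offsets: 0. -/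
def CompanionParityLaw (p : ℕ) [Fact p.Prime] : Prop :=
  ∀ (W : WeierstrassCurve ℚ) [W.IsElliptic] [W.IsGloballyMinimal],
    ClassX1 W p → W.analyticRank = 0 → (p : ℕ) ∣ W.torsionOrder → Semistable W →
    ∀ (d₁ d₂ : ℤ) (W₁ W₂ : WeierstrassCurve ℚ) [W₁.IsElliptic] [W₁.IsGloballyMinimal]
      [W₂.IsElliptic] [W₂.IsGloballyMinimal],
      Admissible W p d₁ → Admissible W p d₂ → SameSplitting W d₁ d₂ →
      IsCompanion W d₁ W₁ → IsCompanion W d₂ W₂ → W₁.analyticRank = 0 → W₂.analyticRank = 0 →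
      ∀ q₁ q₂ : ℚ, IsLalg W₁ q₁ → IsLalg W₂ q₂ → Even (padicValRat p q₁ - padicValRat p q₂)

/-- **Posited interface (no axioms inside).** The two `p`-adic invariants the definite road reads:
`periodExp d = ord_p P_K(f)` (the Gross period = sum of the Jacquet–Langlands vector of `f_W` over the
Gross points of `K = ℚ(√d)` on the definite Shimura set of discriminant `N⁻(d)`), and
`defect d = ε_p(W, N⁻(d))` = the `p`-adic Eisenstein defect of the Ribet–Takahashi comparison
`ord_p deg φ_{X₀(N)} − ord_p (⟨f^{JL},f^{JL}⟩ · ∏_{q ∣ N⁻} c_q)` plus the explicit local constants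
of the Cai–Shu–Tian formula. CONSTRUCTION (that these come from an actual `B`, `f^{JL}`) is the
content of `SquareLaw`, not of the structure. -/
structure DefiniteShadow (W : WeierstrassCurve ℚ) (p : ℕ) where
  periodExp : ℤ → ℕ
  defect : ℤ → ℤ

variable {W : WeierstrassCurve ℚ} {p : ℕ}

/-- **K1 · SquareLaw (analytic, essentially PUBLISHED: Gross 1987 §11, Zhang 2001, Cai–Shu–Tian 2014
explicit Waldspurger/Gross–Zagier; Ribet–Takahashi 1997 / Takahashi 2001 for the degree ratio).**
For every definite-admissible companion: `ord_p(L(W,1)/Ω_W) + ord_p(L(W^{(d)},1)/Ω_{W^{(d)}})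
= 2·ord_p P_K(f) + ε_p(W,N⁻(d))`, and `ε_p` depends on `d` only through the splitting data.
Why it might fail AS TYPED: the `p`-integrality bookkeeping of the explicit constant at a prime
`p ∣ #W(ℚ)_tors` (periods `Ω_W Ω_{W^{(d)}} √|d|` vs `8π²⟨f,f⟩/deg φ`, Manin constant, `u_K`). -/
def SquareLaw (W : WeierstrassCurve ℚ) [W.IsElliptic] (p : ℕ) (S : DefiniteShadow W p) : Prop :=
  (∀ (d : ℤ) (Wd : WeierstrassCurve ℚ) [Wd.IsElliptic] [Wd.IsGloballyMinimal],
    Admissible W p d → IsCompanion W d Wd → Wd.analyticRank = 0 →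
    ∀ q qd : ℚ, IsLalg W q → IsLalg Wd qd →
      padicValRat p q + padicValRat p qd = 2 * (S.periodExp d : ℤ) + S.defect d) ∧
  (∀ d₁ d₂ : ℤ, Admissible W p d₁ → Admissible W p d₂ → SameSplitting W d₁ d₂ →
    S.defect d₁ = S.defect d₂)

/-- **K2 · PeriodUnitExists (analytic mod p; sources: Vatsal 2003 Duke 116 Thm 1.1 / Lemma 2.8
(`C_Eis`), Kriz–Li 2019 Thm 1.20 (log-version of the Eisenstein congruence), Michel 2004 /
Jetchev–Kane 2011 (equidistribution of Gross points among the classes of `B`)).** In every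
splitting class of definite-admissible `d` there is one whose companion has analytic rank 0 and
whose Gross period `P_K(f)` is a `p`-adic UNIT. Why it might fail: multiplicity one of the
Eisenstein eigensystem in `𝔽_p[X_B]` fails (then `f^{JL} mod 𝔭` need not see the class number), and
equidistribution controls measures, not residues mod `p`. -/
def PeriodUnitExists (W : WeierstrassCurve ℚ) [W.IsElliptic] (p : ℕ) (S : DefiniteShadow W p) :
    Prop :=
  ∀ d₀ : ℤ, Admissible W p d₀ →
    ∃ (d : ℤ) (Wd : WeierstrassCurve ℚ) (_ : Wd.IsElliptic) (_ : Wd.IsGloballyMinimal),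
      Admissible W p d ∧ SameSplitting W d₀ d ∧ IsCompanion W d Wd ∧ Wd.analyticRank = 0 ∧
      S.periodExp d = 0

/-- **K3 · DefectVisible (the NEW load-bearing crux; `L`-free).** At a period-unit companion, the
Eisenstein degree defect net of the companion's rank-0 exponent (KNOWN: the companion is of
Greenberg–Vatsal type, `bsdp_of_gvPar_of_analyticRank_eq_zero`) is carried by the algebraic side of
`W`: `ε_p − ord_p(L(W^{(d)},1)/Ω) ≤ ord_p #Ш(W) + ord_p ∏c(W) − 2 ord_p #W(ℚ)_tors`. Mechanism to
prove it: `ε_p` lives in the Eisenstein parts of the component/character groups of `J₀(N)` and of the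
Shimura curve `X^{N⁻q}` at one inert prime (Ribet's exact sequence; Emerton 2003 / Yoo 2016-19 compute
`Φ_𝔪`), and classes of `Ш(W)[p]` are to be produced VISIBLY from `ker(J₀(N)^{q-new} → J^{N⁻})_𝔪`.
Why it might fail: the defect may sit in the cokernel of `Φ_q(J₀(N))_𝔪 → Φ_q(W)` (pure torsion /
Tamagawa bookkeeping) with nothing left for `Ш` — exactly the deep cells would then violate it. -/
def DefectVisible (W : WeierstrassCurve ℚ) [W.IsElliptic] (p : ℕ) (S : DefiniteShadow W p) : Prop :=
  ∀ (d : ℤ) (Wd : WeierstrassCurve ℚ) [Wd.IsElliptic] [Wd.IsGloballyMinimal],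
    Admissible W p d → IsCompanion W d Wd → Wd.analyticRank = 0 → S.periodExp d = 0 →
    ∀ qd : ℚ, IsLalg Wd qd →
      S.defect d - padicValRat p qd ≤
        (padicValNat p W.shaOrder : ℤ) + padicValNat p W.tamagawaProduct -
          2 * padicValNat p W.torsionOrder

/-- PUBLISHED input used by the composition: in analytic rank 0 the algebraic `L`-value
`L(V,1)/Ω_V` is a rational number (Manin–Drinfeld / modular symbols; the tree states it inside the
`PPartRankZero` shape of every rank-0 vendored fact). Kept as an explicit hypothesis. -/
def RankZeroLalgRational : Prop :=
  ∀ (V : WeierstrassCurve ℚ) [V.IsElliptic], V.analyticRank = 0 → ∃ q : ℚ, IsLalg V q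

/-- **Composition (PROVED, no sorry): the definite road yields the missing rank-0 LOWER bound in
print-shape currency.** Given one admissible `d₀` (g5's `DefinitePartnerExists`, Friedberg–Hoffstein),
`SquareLaw ∧ PeriodUnitExists ∧ DefectVisible` give `ord_p(L(W,1)/Ω_W) ≤ ord_p #Ш(W) + ord_p ∏c −
2 ord_p #tors` — the inequality which, with Kato–Wuthrich's upper bound, is `BSD(W,p)` (tree:
`PPartRankZero`, `bsdp_of_pPart`, `bsdp_of_missingLowerBoundAt_of_wuthrich`), and pairwise `BSDp` on the
rank-0 X1 leaf is the crux (`mazurMCOnX1RankZero_iff_forall_bsdp`). -/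
theorem lalgExp_le_of_squareLaw (hrat : RankZeroLalgRational) (W : WeierstrassCurve ℚ)
    [W.IsElliptic] (p : ℕ) (S : DefiniteShadow W p) (hsq : SquareLaw W p S)
    (hunit : PeriodUnitExists W p S) (hvis : DefectVisible W p S) {d₀ : ℤ}
    (hd₀ : Admissible W p d₀) {q : ℚ} (hq : IsLalg W q) :
    padicValRat p q ≤
      (padicValNat p W.shaOrder : ℤ) + padicValNat p W.tamagawaProduct -
        2 * padicValNat p W.torsionOrder := by
  obtain ⟨d, Wd, hE, hM, hadm, _, hcomp, hr0, hper⟩ := hunit d₀ hd₀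
  obtain ⟨qd, hqd⟩ := hrat Wd hr0
  have h1 := hsq.1 d Wd hadm hcomp hr0 q qd hq hqd
  have h2 := hvis d Wd hadm hcomp hr0 hper qd hqd
  rw [hper] at h1
  push_cast at h1
  linarith

/-- **The crux-level statement of the line (what K1 ∧ K2 ∧ K3 deliver class-wide on the θ = 1,
semistable leaf):** every such rank-0 X1 curve satisfies the rank-0 print-shape LOWER bound. The
remaining conversions to the crux are tree bookkeeping + published inputs (module docstring). -/
def DefiniteRoadLowerBound (p : ℕ) [Fact p.Prime] : Prop :=
  ∀ (W : WeierstrassCurve ℚ) [W.IsElliptic] [W.IsGloballyMinimal],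
    ClassX1 W p → W.analyticRank = 0 → (p : ℕ) ∣ W.torsionOrder → Semistable W →
    ∀ q : ℚ, IsLalg W q →
      padicValRat p q ≤
        (padicValNat p W.shaOrder : ℤ) + padicValNat p W.tamagawaProduct -
          2 * padicValNat p W.torsionOrder

/-- Class-wide packaging (PROVED): shadows with the three laws on the leaf, plus one admissible
companion discriminant per curve (g5's P1 / Friedberg–Hoffstein–Waldspurger), give
`DefiniteRoadLowerBound p`. -/
theorem definiteRoadLowerBound_of_laws (p : ℕ) [Fact p.Prime] (hrat : RankZeroLalgRational)
    (hlaws : ∀ (W : WeierstrassCurve ℚ) [W.IsElliptic] [W.IsGloballyMinimal],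
      ClassX1 W p → W.analyticRank = 0 → (p : ℕ) ∣ W.torsionOrder → Semistable W →
      ∃ S : DefiniteShadow W p, SquareLaw W p S ∧ PeriodUnitExists W p S ∧ DefectVisible W p S)
    (hpartner : ∀ (W : WeierstrassCurve ℚ) [W.IsElliptic] [W.IsGloballyMinimal],
      ClassX1 W p → W.analyticRank = 0 → ∃ d₀ : ℤ, Admissible W p d₀) :
    DefiniteRoadLowerBound p := by
  intro W _ _ hX hr hT hss q hq
  obtain ⟨S, hsq, hunit, hvis⟩ := hlaws W hX hr hT hss
  obtain ⟨d₀, hd₀⟩ := hpartner W hX hr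
  exact lalgExp_le_of_squareLaw hrat W p S hsq hunit hvis hd₀ hq

end Summit.BirchSwinnertonDyer.BirchSwinnertonDyer.Cruxes.MazurMCOnX1RankZero.DefiniteSquareLaw
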